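import Summits.QuantumFields.YangMills.Theorems.ColdStartUniversalityLatticeLangevinKuwadaDuality
import HarnessLib

/-!
# HYPERCONTRACTIVITY OF THE HOPF–LAX SEMIGROUP FROM A LOG-SOBOLEV INEQUALITY (Bobkov–Gentil–Ledoux / Bakry–Gentil–Ledoux Thm 9.5.1) on a compact
# metric probability space, and the dual form of Talagrand's `T₂`: `∫ e^{Q_C f} dμ ≤ e^{∫ f dμ}` (Otto–Villani, BGL Thm 9.6.1)

Seat `ym-line-csu-p1` (g42), route `ColdStartUniversality` of `Summits/QuantumFields/YangMills`, helper file G69a (`--supports stmt-QuantumFields-24809`).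
GENERIC (any compact metric space `X`, Borel probability measure `μ`; instantiated in the sequel with `X = SU(2)^E`, `ρ_L`, `μ = μ_(β')`).
The log-Sobolev inequality is taken in the form adapted to Lipschitz functions with LOCAL Lipschitz majorants (the form the tree can supply by
mollification, cf. G63c): `Ent_μ(e^F) ≤ (C/2)·∫G²e^F dμ` whenever `F` is `G(w)`-Lipschitz on each ball `B̄(w,R)`.  The Hamilton–Jacobi structure
of the Hopf–Lax semigroup enters through G62 (time inequality `Q_{t'}f ≤ Q_tf − δD_t⁺²/(2tt')`, slope majorants `(sup_{B̄(w,R)}D_t⁺ + R)/t`), exactly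
as in Kuwada's duality (G64a): along `q(t) = a + t/C` the functional `H(t) = q(t)⁻¹ log ∫e^{q(t)Q_tf}dμ` has `O(δ²)` increments, hence is non-increasing.

PART I (this file, G69a): ★ `sub_le_of_small_step_bound` — telescoping with a superlinear error and a mesh constraint; ★★ `hopfLax_entropy_le` —
`Ent_μ(e^{qQ_tf}) ≤ (Cq²/(2t²))·∫(D_t⁺)²e^{qQ_tf}dμ` (the LSI at the exact Hopf–Lax slope, by dominated convergence over the ball majorants).
Parts II/III (sequel files): the `O(δ²)` step, monotonicity, and `∫e^{Q_C f}dμ ≤ e^{∫f dμ}` / Talagrand's `T₂`.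

THEOREMS ONLY, no definition, no sorry.  HONEST FRAMING: abstract metric-measure lemmas; nothing here is specific to Yang–Mills; no crux, rung or
summit statement is proved; the Yang–Mills mass gap is NOT proved.
-/

set_option autoImplicit false

noncomputable section

namespace Summit.QuantumFields.YangMills.Theorems.ColdStartUniversality

open MeasureTheory ProbabilityTheory Filter Topology Set Metric
open scoped BigOperators

/-! ## §1. Telescoping with a mesh constraint -/

/-- ★ **Telescoping with a superlinear error, small steps only.**  If `h(s') − h(s) ≤ (s'−s)·C + (s'−s)·√(s'−s)·K` whenever
`s₀ ≤ s ≤ s' ≤ 1` and `s' − s ≤ η` (`η > 0`, `s₀ ≤ 1`), then `h(1) − h(s₀) ≤ (1 − s₀)·C`. [folklore] -/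
theorem sub_le_of_small_step_bound {h : ℝ → ℝ} {s₀ C K η : ℝ} (hs₀1 : s₀ ≤ 1) (hη : 0 < η)
    (hstep : ∀ s s' : ℝ, s₀ ≤ s → s ≤ s' → s' ≤ 1 → s' - s ≤ η → h s' - h s ≤ (s' - s) * C + (s' - s) * Real.sqrt (s' - s) * K) :
    h 1 - h s₀ ≤ (1 - s₀) * C := by
  have h1s : 0 ≤ 1 - s₀ := by linarith
  -- the bound with `n+1` steps, for `n` large
  have hn : ∀ n : ℕ, (1 - s₀) / ((n : ℝ) + 1) ≤ η → h 1 - h s₀ ≤ (1 - s₀) * C + (1 - s₀) * Real.sqrt ((1 - s₀) / ((n : ℝ) + 1)) * K := by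
    intro n hnη
    obtain ⟨δ, hδ⟩ : ∃ δ : ℝ, δ = (1 - s₀) / ((n : ℝ) + 1) := ⟨_, rfl⟩
    have hδ0 : 0 ≤ δ := by rw [hδ]; positivity
    have hδη : δ ≤ η := by rw [hδ]; exact hnη
    have hnδ : ((n : ℝ) + 1) * δ = 1 - s₀ := by rw [hδ]; field_simp
    have P : ∀ k : ℕ, k ≤ n + 1 → h (s₀ + (k : ℝ) * δ) - h s₀ ≤ (k : ℝ) * δ * C + (k : ℝ) * δ * Real.sqrt δ * K := by
      intro k
      induction k with
      | zero => intro _; simp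
      | succ k ih =>
        intro hk
        have hk' : k ≤ n + 1 := Nat.le_of_succ_le hk
        have h0 := ih hk'
        have hkle : ((k : ℝ) + 1) ≤ (n : ℝ) + 1 := by exact_mod_cast hk
        have hs1 : s₀ ≤ s₀ + (k : ℝ) * δ := by nlinarith [(Nat.cast_nonneg k : (0 : ℝ) ≤ k)]
        have hs2 : s₀ + (k : ℝ) * δ ≤ s₀ + ((k : ℝ) + 1) * δ := by nlinarith
        have hs3 : s₀ + ((k : ℝ) + 1) * δ ≤ 1 := by nlinarith
        have e : s₀ + ((k : ℝ) + 1) * δ - (s₀ + (k : ℝ) * δ) = δ := by ring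
        have h1 := hstep _ _ hs1 hs2 hs3 (by rw [e]; exact hδη)
        rw [e] at h1
        push_cast
        linarith
    have h2 := P (n + 1) le_rfl
    have e1 : s₀ + ((n + 1 : ℕ) : ℝ) * δ = 1 := by push_cast; linarith
    have e2 : ((n + 1 : ℕ) : ℝ) * δ = 1 - s₀ := by push_cast; linarith
    rw [e1, e2] at h2
    rw [← hδ]
    exact h2
  have hlim0 : Tendsto (fun n : ℕ => (1 - s₀) / ((n : ℝ) + 1)) atTop (𝓝 0) := by
    have := tendsto_one_div_add_atTop_nhds_zero_nat.const_mul (1 - s₀)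
    rw [mul_zero] at this
    refine this.congr fun n => ?_
    field_simp
  have hlim : Tendsto (fun n : ℕ => (1 - s₀) * C + (1 - s₀) * Real.sqrt ((1 - s₀) / ((n : ℝ) + 1)) * K) atTop (𝓝 ((1 - s₀) * C + (1 - s₀) * Real.sqrt 0 * K)) :=
    tendsto_const_nhds.add ((hlim0.sqrt.const_mul (1 - s₀)).mul_const K)
  rw [Real.sqrt_zero, mul_zero, zero_mul, add_zero] at hlim
  have hev : ∀ᶠ n : ℕ in atTop, h 1 - h s₀ ≤ (1 - s₀) * C + (1 - s₀) * Real.sqrt ((1 - s₀) / ((n : ℝ) + 1)) * K := by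
    have h1 : ∀ᶠ n : ℕ in atTop, (1 - s₀) / ((n : ℝ) + 1) < η := hlim0 (Iio_mem_nhds hη)
    filter_upwards [h1] with n hn1 using hn n hn1.le
  exact ge_of_tendsto hlim hev

/-! ## §2. The log-Sobolev inequality at the exact Hopf–Lax slope -/

variable {X : Type*} [MetricSpace X] [CompactSpace X] [MeasurableSpace X] [BorelSpace X]

/-- ★★ **LSI for `e^{qQ_tf}` at the exact slope `D_t⁺/t`.**  Under the local-majorant log-Sobolev hypothesis with constant `C`: for Lipschitz `f`,
`t > 0`, `q ≥ 0`:  `∫qQ_tf·e^{qQ_tf} dμ − Λ log Λ ≤ (C·q²/(2t²))·∫(D_t⁺)² e^{qQ_tf} dμ`, `Λ = ∫e^{qQ_tf}dμ` (the ball majorants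
`q(sup_{B̄(w,R)}D_t⁺ + R)/t` of G62/G64a and dominated convergence `R → 0`). [cite: BakryGentilLedoux2014, Thm 9.5.1] -/
theorem hopfLax_entropy_le (μ : Measure X) [IsProbabilityMeasure μ] {C : ℝ}
    (hLS : ∀ (F : X → ℝ) (Lf : ℝ), 0 ≤ Lf → (∀ z z' : X, |F z' - F z| ≤ Lf * dist z z') → ∀ (R : ℝ), 0 < R →
      ∀ (G : X → ℝ) (M : ℝ), UpperSemicontinuous G → (∀ w, 0 ≤ G w) → (∀ w, G w ≤ M) →
      (∀ w z' z'' : X, dist w z' ≤ R → dist w z'' ≤ R → |F z'' - F z'| ≤ G w * dist z' z'') →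
      ∫ x, F x * Real.exp (F x) ∂μ - (∫ x, Real.exp (F x) ∂μ) * Real.log (∫ x, Real.exp (F x) ∂μ) ≤ C / 2 * ∫ x, G x ^ 2 * Real.exp (F x) ∂μ)
    {f : X → ℝ} (hf : Continuous f) {Lf : ℝ} (hLf : 0 ≤ Lf) (hlip : ∀ z w, |f z - f w| ≤ Lf * dist z w)
    {t : ℝ} (ht : 0 < t) {q : ℝ} (hq : 0 ≤ q) :
    ∫ x, (q * ⨅ v, (f v + dist x v ^ 2 / (2 * t))) * Real.exp (q * ⨅ v, (f v + dist x v ^ 2 / (2 * t))) ∂μ -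
        (∫ x, Real.exp (q * ⨅ v, (f v + dist x v ^ 2 / (2 * t))) ∂μ) * Real.log (∫ x, Real.exp (q * ⨅ v, (f v + dist x v ^ 2 / (2 * t))) ∂μ) ≤
      C * q ^ 2 / (2 * t ^ 2) * ∫ x, (sSup ((fun v => dist x v) '' {v | ∀ v' : X, f v + dist x v ^ 2 / (2 * t) ≤ f v' + dist x v' ^ 2 / (2 * t)})) ^ 2 *
        Real.exp (q * ⨅ v, (f v + dist x v ^ 2 / (2 * t))) ∂μ := by
  obtain ⟨Qf, hQf⟩ : ∃ Qf : X → ℝ, Qf = fun x => ⨅ v, (f v + dist x v ^ 2 / (2 * t)) := ⟨_, rfl⟩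
  obtain ⟨D, hD⟩ : ∃ D : X → ℝ, D = fun x => sSup ((fun v => dist x v) '' {v | ∀ v' : X, f v + dist x v ^ 2 / (2 * t) ≤ f v' + dist x v' ^ 2 / (2 * t)}) := ⟨_, rfl⟩
  have hQfw : ∀ w, Qf w = ⨅ v, (f v + dist w v ^ 2 / (2 * t)) := fun w => by rw [hQf]
  have hDw : ∀ w, D w = sSup ((fun v => dist w v) '' {v | ∀ v' : X, f v + dist w v ^ 2 / (2 * t) ≤ f v' + dist w v' ^ 2 / (2 * t)}) := fun w => by rw [hD]
  have hgoal : ∫ x, (q * Qf x) * Real.exp (q * Qf x) ∂μ - (∫ x, Real.exp (q * Qf x) ∂μ) * Real.log (∫ x, Real.exp (q * Qf x) ∂μ) ≤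
      C * q ^ 2 / (2 * t ^ 2) * ∫ x, D x ^ 2 * Real.exp (q * Qf x) ∂μ := by
    have hFlip : ∀ u u' : X, |q * Qf u' - q * Qf u| ≤ q * (3 * Lf) * dist u u' := fun u u' => by
      rw [← mul_sub, abs_mul, abs_of_nonneg hq, mul_assoc]
      exact mul_le_mul_of_nonneg_left (by rw [hQfw, hQfw]; exact hopfLax_lipschitz hf hLf hlip ht u u') hq
    have hQc : Continuous Qf := by rw [hQf]; exact hopfLax_continuous hf hLf hlip ht
    have hDusc : UpperSemicontinuous D := by rw [hD]; exact hopfLaxFar_upperSemicontinuous hf t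
    have hD0 : ∀ w, 0 ≤ D w := fun w => by rw [hDw]; exact hopfLaxFar_nonneg hf t w
    have hDle : ∀ w, D w ≤ 2 * t * Lf := fun w => by rw [hDw]; exact hopfLaxFar_le hf hLf hlip ht w
    have hslope : ∀ u u' : X, Qf u' - Qf u ≤ dist u u' * (2 * D u + dist u u') / (2 * t) := fun u u' => by
      rw [hQfw, hQfw, hDw]; exact hopfLax_slope_le hf ht u u'
    have hRpos : ∀ n : ℕ, (0 : ℝ) < 1 / ((n : ℝ) + 1) := fun n => by positivity
    have hRle : ∀ n : ℕ, 1 / ((n : ℝ) + 1) ≤ 1 := fun n => by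
      rw [div_le_one (by positivity)]; linarith [(Nat.cast_nonneg n : (0 : ℝ) ≤ n)]
    have hsupD0 : ∀ (n : ℕ) (w : X), D w ≤ sSup (D '' closedBall w (1 / ((n : ℝ) + 1))) := fun n w =>
      le_sSup_closedBall hDusc w _ (mem_closedBall_self (hRpos n).le)
    have hsupDle : ∀ (n : ℕ) (w : X), sSup (D '' closedBall w (1 / ((n : ℝ) + 1))) ≤ 2 * t * Lf := fun n w =>
      csSup_le ⟨D w, ⟨w, mem_closedBall_self (hRpos n).le, rfl⟩⟩ (by rintro _ ⟨v, -, rfl⟩; exact hDle v)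
    -- the majorants `G_n = q·(sup_{B̄(w,R_n)} D + R_n)/t`
    have hGusc : ∀ n : ℕ, UpperSemicontinuous fun w => q * ((sSup (D '' closedBall w (1 / ((n : ℝ) + 1))) + 1 / ((n : ℝ) + 1)) / t) := by
      intro n
      have h1 : UpperSemicontinuous fun w => sSup (D '' closedBall w (1 / ((n : ℝ) + 1))) := upperSemicontinuous_sSup_closedBall hDusc (hRpos n).le
      have h2 : UpperSemicontinuous fun w => sSup (D '' closedBall w (1 / ((n : ℝ) + 1))) + 1 / ((n : ℝ) + 1) := h1.add upperSemicontinuous_const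
      have hc : Continuous fun u : ℝ => q * (u / t) := continuous_const.mul (continuous_id.div_const t)
      exact hc.comp_upperSemicontinuous h2 (fun u v huv => mul_le_mul_of_nonneg_left (div_le_div_of_nonneg_right huv ht.le) hq)
    have hG0 : ∀ (n : ℕ) (w : X), 0 ≤ q * ((sSup (D '' closedBall w (1 / ((n : ℝ) + 1))) + 1 / ((n : ℝ) + 1)) / t) := fun n w =>
      mul_nonneg hq (div_nonneg (by linarith [hD0 w, hsupD0 n w, (hRpos n).le]) ht.le)
    have hGM : ∀ (n : ℕ) (w : X), q * ((sSup (D '' closedBall w (1 / ((n : ℝ) + 1))) + 1 / ((n : ℝ) + 1)) / t) ≤ q * ((2 * t * Lf + 1) / t) :=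
      fun n w => mul_le_mul_of_nonneg_left (div_le_div_of_nonneg_right (by linarith [hsupDle n w, hRle n]) ht.le) hq
    have hloc : ∀ (n : ℕ) (w u u' : X), dist w u ≤ 1 / ((n : ℝ) + 1) → dist w u' ≤ 1 / ((n : ℝ) + 1) →
        |q * Qf u' - q * Qf u| ≤ q * ((sSup (D '' closedBall w (1 / ((n : ℝ) + 1))) + 1 / ((n : ℝ) + 1)) / t) * dist u u' := by
      intro n w u u' hu hu'
      have hσu : D u ≤ sSup (D '' closedBall w (1 / ((n : ℝ) + 1))) := le_sSup_closedBall hDusc w _ (by rw [mem_closedBall, dist_comm]; exact hu)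
      have hσu' : D u' ≤ sSup (D '' closedBall w (1 / ((n : ℝ) + 1))) := le_sSup_closedBall hDusc w _ (by rw [mem_closedBall, dist_comm]; exact hu')
      have hdd : dist u u' ≤ 2 * (1 / ((n : ℝ) + 1)) := by
        have := dist_triangle u w u'; rw [dist_comm u w] at this; linarith
      have h1 := hslope u u'
      have h2 := hslope u' u
      rw [dist_comm u' u] at h2
      have hd0 : 0 ≤ dist u u' := dist_nonneg
      have key : ∀ Dv : ℝ, Dv ≤ sSup (D '' closedBall w (1 / ((n : ℝ) + 1))) →
          dist u u' * (2 * Dv + dist u u') / (2 * t) ≤ (sSup (D '' closedBall w (1 / ((n : ℝ) + 1))) + 1 / ((n : ℝ) + 1)) / t * dist u u' := by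
        intro Dv hDv
        have hk : 2 * Dv + dist u u' ≤ 2 * (sSup (D '' closedBall w (1 / ((n : ℝ) + 1))) + 1 / ((n : ℝ) + 1)) := by linarith
        rw [div_mul_eq_mul_div, div_le_div_iff₀ (by linarith) ht]
        calc dist u u' * (2 * Dv + dist u u') * t = (dist u u' * t) * (2 * Dv + dist u u') := by ring
          _ ≤ (dist u u' * t) * (2 * (sSup (D '' closedBall w (1 / ((n : ℝ) + 1))) + 1 / ((n : ℝ) + 1))) :=
              mul_le_mul_of_nonneg_left hk (mul_nonneg hd0 ht.le)
          _ = (sSup (D '' closedBall w (1 / ((n : ℝ) + 1))) + 1 / ((n : ℝ) + 1)) * dist u u' * (2 * t) := by ring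
      have hQ : |Qf u' - Qf u| ≤ (sSup (D '' closedBall w (1 / ((n : ℝ) + 1))) + 1 / ((n : ℝ) + 1)) / t * dist u u' := by
        rw [abs_le]; constructor
        · linarith [key (D u') hσu']
        · linarith [key (D u) hσu]
      rw [← mul_sub, abs_mul, abs_of_nonneg hq, mul_assoc]
      exact mul_le_mul_of_nonneg_left hQ hq
    -- LSI at scale `R_n`
    have hstep : ∀ n : ℕ, ∫ x, (q * Qf x) * Real.exp (q * Qf x) ∂μ - (∫ x, Real.exp (q * Qf x) ∂μ) * Real.log (∫ x, Real.exp (q * Qf x) ∂μ) ≤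
        C / 2 * ∫ x, (q * ((sSup (D '' closedBall x (1 / ((n : ℝ) + 1))) + 1 / ((n : ℝ) + 1)) / t)) ^ 2 * Real.exp (q * Qf x) ∂μ :=
      fun n => hLS (fun x => q * Qf x) (q * (3 * Lf)) (by positivity) hFlip (1 / ((n : ℝ) + 1)) (hRpos n) _ (q * ((2 * t * Lf + 1) / t))
        (hGusc n) (hG0 n) (hGM n) (hloc n)
    -- dominated convergence `n → ∞`
    have hEc : Continuous fun x => Real.exp (q * Qf x) := Real.continuous_exp.comp (continuous_const.mul hQc)
    obtain ⟨E₀, hE₀⟩ := (isCompact_range hEc).bddAbove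
    have hE₀' : ∀ x, Real.exp (q * Qf x) ≤ E₀ := fun x => hE₀ ⟨x, rfl⟩
    have hlimG : ∀ w, Tendsto (fun n : ℕ => (q * ((sSup (D '' closedBall w (1 / ((n : ℝ) + 1))) + 1 / ((n : ℝ) + 1)) / t)) ^ 2 * Real.exp (q * Qf w)) atTop
        (𝓝 ((q * (D w / t)) ^ 2 * Real.exp (q * Qf w))) := by
      intro w
      have h1 : Tendsto (fun n : ℕ => sSup (D '' closedBall w (1 / ((n : ℝ) + 1)))) atTop (𝓝 (D w)) := tendsto_sSup_closedBall hDusc w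
      have h2 : Tendsto (fun n : ℕ => 1 / ((n : ℝ) + 1)) atTop (𝓝 0) := tendsto_one_div_add_atTop_nhds_zero_nat
      have h3 := ((((h1.add h2).div_const t).const_mul q).pow 2).mul_const (Real.exp (q * Qf w))
      rw [add_zero] at h3
      exact h3
    have hlimI : Tendsto (fun n : ℕ => ∫ x, (q * ((sSup (D '' closedBall x (1 / ((n : ℝ) + 1))) + 1 / ((n : ℝ) + 1)) / t)) ^ 2 * Real.exp (q * Qf x) ∂μ) atTop
        (𝓝 (∫ x, (q * (D x / t)) ^ 2 * Real.exp (q * Qf x) ∂μ)) := by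
      refine tendsto_integral_of_dominated_convergence (fun _ => (q * ((2 * t * Lf + 1) / t)) ^ 2 * E₀)
        (fun n => (((hGusc n).measurable.pow_const 2).mul hEc.measurable).aestronglyMeasurable)
        (integrable_const _) (fun n => ae_of_all _ fun w => ?_) (ae_of_all _ hlimG)
      rw [Real.norm_eq_abs, abs_of_nonneg (mul_nonneg (sq_nonneg _) (Real.exp_pos _).le)]
      exact mul_le_mul (pow_le_pow_left₀ (hG0 n w) (hGM n w) 2) (hE₀' w) (Real.exp_pos _).le (sq_nonneg _)
    have hle := ge_of_tendsto' (hlimI.const_mul (C / 2)) hstep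
    have hI : ∫ x, (q * (D x / t)) ^ 2 * Real.exp (q * Qf x) ∂μ = q ^ 2 / t ^ 2 * ∫ x, D x ^ 2 * Real.exp (q * Qf x) ∂μ := by
      rw [← integral_const_mul]
      refine integral_congr_ae (ae_of_all _ fun w => ?_)
      show (q * (D w / t)) ^ 2 * Real.exp (q * Qf w) = q ^ 2 / t ^ 2 * (D w ^ 2 * Real.exp (q * Qf w))
      field_simp
    rw [hI] at hle
    calc _ ≤ C / 2 * (q ^ 2 / t ^ 2 * ∫ x, D x ^ 2 * Real.exp (q * Qf x) ∂μ) := hle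
      _ = C * q ^ 2 / (2 * t ^ 2) * ∫ x, D x ^ 2 * Real.exp (q * Qf x) ∂μ := by field_simp
  rw [hQf, hD] at hgoal
  exact hgoal

end Summit.QuantumFields.YangMills.Theorems.ColdStartUniversality

end
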